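import Mathlib
import HarnessLib
import Summits.HubbardSuperconductivity.HubbardSuperconductivity.Theorems.KLProgrammeLocalisedCooperD4

/-!
# Route `KLProgramme` — `D₄` on the localised Cooper array, II: the sector weights are equivariant; the hypothesis `hπ` of
# `KLProgrammeLocalisedCooper.lean` DISCHARGED

Cell gate-hubbard-kl, seat p3; continuation of `KLProgrammeLocalisedCooperD4.lean`.

* §8 `d4Site_mem_momentumShell_iff`, `sum_momentumShell_d4Site` (the renormalised shell `|e_K| ≤ Λ` is `D₄`-stable:
  `nambuXiCT_d4Site`; shell sums reindex under `d4Site γ`), **`klSectorWeight_rev/_quarter`** — the sector weights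
  `w_ω̄ = Σ_{k⃗ ∈ S_Λ} ν_Λ(k⃗) ζ̃_{2n,ω̄}(θ(k⃗))` satisfy `w_{N-1-ω̄} = w_ω̄`, `w_{ω̄+N/4} = w_ω̄` when the shell avoids the origin and the
  zone boundary (`bcsMeasure_d4Site` for the `D₄`-invariant scale-`n` action, `kernel_hubbardEffectiveActionCT_d4Field`);
* §9 `DihedralGroup.forall_exists_of_generators` — a `γ`-indexed family of witnesses closed under products with witnesses at `1`,
  `r 1`, `sr 0` has a witness at every `γ ∈ D₄`;
* §10 **`klSectorSite_equivariant`** (sites only: `-4 < μ < 0`, `n ≥ 1`) and **`klLocCooper_sectorEquivariance`** — for `-4 < μ < 0`,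
  `n ≥ 1` and a scale-`n` shell with `k⃗ ≠ 0`, `2kᵢ ≠ L`:
  `∀ γ, ∃ σ : Perm (Fin N), (∀ ω̄, klSectorSite (σ ω̄) = d4Site γ (klSectorSite ω̄)) ∧ (∀ ω̄, klSectorWeight (σ ω̄) = klSectorWeight ω̄)`
  — verbatim the hypothesis `hπ` of `klLocCooperMatrix_d4Site` / `klLocCooperOp_comm` / `klLocBlockInf_eq_formInf` /
  `le_formInf_klLocCooperOp`, so C2 (`blockFlow_envelopes`, `attractive_upper_envelope`, …) applies to the localised blocks
  `klLocBlockInf/Sup` unconditionally in the regime;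
* §11 `momentumShell_regular` — the shell condition from two inequalities: `Λ + Σ|κ| < -μ` and `Λ + Σ|κ| < 4 + μ`
  (`Σ|κ| = K.coeffNorm 0 ≥ sup|K|`; at `k⃗ = 0`, `ε = -4`; on the zone boundary `ε ≥ 0`).

Everything is proved; no definitions.  References: HOME/p3/C2-LEAN-GUIDE.md §2–§4; HOME/p1/ENGINE-PRED.md §0 Q-E2, §7.
-/

noncomputable section

namespace Summit.HubbardSuperconductivity.HubbardSuperconductivity.Theorems.KLProgrammeLegKernels

set_option linter.dupNamespace false -- summit = problem name (single-conjunct summit), D-0017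

open Real Literature.MathematicalPhysics.QuantumLattice Literature.Probability.LatticeModels
open Summit.HubbardSuperconductivity.HubbardSuperconductivity.Theorems.CooperVertexBlocks

/-! ### §8 Shell sums are `D₄`-invariant; the sector weights are equivariant (generators) -/

section Weights

variable (L M : ℕ) [NeZero L] [NeZero M]

/-- The renormalised shell is `D₄`-stable. -/
theorem d4Site_mem_momentumShell_iff (μ : ℝ) (K : TrigPolyC4v) (Λ : ℝ) (γ : DihedralGroup 4) (k : TorusSite 2 L) :
    d4Site γ k ∈ momentumShell L (nambuXiCT L μ K) Λ ↔ k ∈ momentumShell L (nambuXiCT L μ K) Λ := by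
  rw [mem_momentumShell, mem_momentumShell, nambuXiCT_d4Site]

/-- **Reindexing a shell sum by a point-group element.** -/
theorem sum_momentumShell_d4Site (μ : ℝ) (K : TrigPolyC4v) (Λ : ℝ) (γ : DihedralGroup 4) (f : TorusSite 2 L → ℝ) :
    ∑ k ∈ momentumShell L (nambuXiCT L μ K) Λ, f (d4Site γ k) = ∑ k ∈ momentumShell L (nambuXiCT L μ K) Λ, f k := by
  refine Finset.sum_nbij' (d4Site γ) (d4Site γ⁻¹) ?_ ?_ ?_ ?_ ?_
  · exact fun k hk => (d4Site_mem_momentumShell_iff L μ K Λ γ k).2 hk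
  · exact fun k hk => (d4Site_mem_momentumShell_iff L μ K Λ γ⁻¹ k).2 hk
  · exact fun k _ => d4Site_inv_apply γ k
  · exact fun k _ => d4Site_apply_inv γ k
  · exact fun k _ => rfl

variable {β U μ : ℝ} {K : TrigPolyC4v} {e₀ : ℝ} {n : ℕ}

/-- **Reflection of sector weights**: `w_{N-1-ω̄} = w_ω̄`, when the scale-`n` shell avoids the origin and the zone boundary. -/
theorem klSectorWeight_rev
    (hsh : ∀ k ∈ momentumShell L (nambuXiCT L μ K) (klScale e₀ n), k ≠ 0 ∧ ∀ j, 2 * (k j).val ≠ L)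
    (ω : Fin (sectorCount (2 * n))) :
    klSectorWeight L M β U μ K e₀ n (Fin.rev ω) = klSectorWeight L M β U μ K e₀ n ω := by
  unfold klSectorWeight
  refine (sum_momentumShell_d4Site L μ K (klScale e₀ n) (DihedralGroup.sr 0) _).symm.trans
    (Finset.sum_congr rfl fun k hk => ?_)
  obtain ⟨-, hkj⟩ := hsh k hk
  have hν : bcsMeasure L M β (klScale e₀ n) (klEffectiveAction L M β U μ K e₀ n) (d4Site (DihedralGroup.sr 0) k) =
      bcsMeasure L M β (klScale e₀ n) (klEffectiveAction L M β U μ K e₀ n) k :=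
    bcsMeasure_d4Site L M (kernel_hubbardEffectiveActionCT_d4Field L M (DihedralGroup.sr 0) β U μ K (klScale e₀ n))
      β (klScale e₀ n) k
  rw [hν]
  congr 1
  have hidx : ((Fin.rev ω : ℕ) : ℤ) = (-1 - ((ω : ℕ) : ℤ)) + (1 : ℕ) * (sectorCount (2 * n) : ℤ) := by
    rw [Fin.val_rev]
    have h : (ω : ℕ) + 1 ≤ sectorCount (2 * n) := ω.2
    push_cast [Nat.cast_sub h]
    ring
  rw [hidx, sectorWeightCirc_add_nat_mul_sectorCount]
  exact sectorWeightCirc_momentumAngle_reflSite L (2 * n) _ (hkj 1)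

/-- **Quarter turn of sector weights**: `w_{ω̄ + N/4} = w_ω̄` (`n ≥ 1`), when the scale-`n` shell avoids the origin and the zone boundary. -/
theorem klSectorWeight_quarter (hn : 1 ≤ n)
    (hsh : ∀ k ∈ momentumShell L (nambuXiCT L μ K) (klScale e₀ n), k ≠ 0 ∧ ∀ j, 2 * (k j).val ≠ L)
    {ω ω' : Fin (sectorCount (2 * n))} (h : (ω' : ℕ) = ((ω : ℕ) + 2 ^ (2 * n - 1)) % sectorCount (2 * n)) :
    klSectorWeight L M β U μ K e₀ n ω' = klSectorWeight L M β U μ K e₀ n ω := by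
  unfold klSectorWeight
  refine (sum_momentumShell_d4Site L μ K (klScale e₀ n) (DihedralGroup.r 1) _).symm.trans
    (Finset.sum_congr rfl fun k hk => ?_)
  obtain ⟨hk0, hkj⟩ := hsh k hk
  have hν : bcsMeasure L M β (klScale e₀ n) (klEffectiveAction L M β U μ K e₀ n) (d4Site (DihedralGroup.r 1) k) =
      bcsMeasure L M β (klScale e₀ n) (klEffectiveAction L M β U μ K e₀ n) k :=
    bcsMeasure_d4Site L M (kernel_hubbardEffectiveActionCT_d4Field L M (DihedralGroup.r 1) β U μ K (klScale e₀ n))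
      β (klScale e₀ n) k
  rw [hν]
  congr 1
  have hnat : (ω' : ℕ) + ((ω : ℕ) + 2 ^ (2 * n - 1)) / sectorCount (2 * n) * sectorCount (2 * n) =
      (ω : ℕ) + 2 ^ (2 * n - 1) := by
    rw [h]
    exact Nat.mod_add_div' _ _
  have hidx : ((ω' : ℕ) : ℤ) + ((((ω : ℕ) + 2 ^ (2 * n - 1)) / sectorCount (2 * n) : ℕ) : ℤ) * (sectorCount (2 * n) : ℤ) =
      ((ω : ℕ) : ℤ) + 2 ^ (2 * n - 1) := by
    exact_mod_cast hnat
  rw [← sectorWeightCirc_add_nat_mul_sectorCount (2 * n) _ (((ω : ℕ) + 2 ^ (2 * n - 1)) / sectorCount (2 * n)), hidx]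
  exact sectorWeightCirc_momentumAngle_rotSite L (by omega) _ hk0 (hkj 1)

end Weights

/-! ### §9 From the generators to the whole point group -/

/-- **Generation of `D₄` by the quarter turn `r 1` and the reflection `sr 0`**: a `γ`-indexed family of
witnesses closed under products and containing witnesses for `1`, `r 1`, `sr 0` has a witness for every `γ`. -/
theorem DihedralGroup.forall_exists_of_generators {α : Type*} (P : DihedralGroup 4 → α → Prop) (op : α → α → α)
    (e : α) (h1 : P 1 e) (hmul : ∀ γ₁ γ₂ a₁ a₂, P γ₁ a₁ → P γ₂ a₂ → P (γ₁ * γ₂) (op a₁ a₂))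
    (hr : ∃ a, P (DihedralGroup.r 1) a) (hs : ∃ a, P (DihedralGroup.sr 0) a) : ∀ γ, ∃ a, P γ a := by
  have hpow : ∀ k : ℕ, ∃ a, P (DihedralGroup.r 1 ^ k) a := by
    intro k
    induction k with
    | zero => exact ⟨e, by simpa using h1⟩
    | succ k ih =>
      obtain ⟨a, ha⟩ := ih
      obtain ⟨b, hb⟩ := hr
      exact ⟨op a b, by rw [pow_succ]; exact hmul _ _ _ _ ha hb⟩
  have hri : ∀ i : ZMod 4, ∃ a, P (DihedralGroup.r i) a := by
    intro i
    obtain ⟨a, ha⟩ := hpow i.val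
    refine ⟨a, ?_⟩
    rwa [DihedralGroup.r_one_pow, ZMod.natCast_zmod_val] at ha
  intro γ
  cases γ with
  | r i => exact hri i
  | sr i =>
    obtain ⟨a, ha⟩ := hs
    obtain ⟨b, hb⟩ := hri i
    refine ⟨op a b, ?_⟩
    have := hmul _ _ _ _ ha hb
    rwa [DihedralGroup.sr_mul_r, zero_add] at this

/-! ### §10 The equivariance theorems -/

/-- The quarter shift `2^{2n-1} = N/4` is a sector index: `2^{2n-1} < N = 2^{2n+1}`. -/
theorem quarterShift_lt (n : ℕ) : 2 ^ (2 * n - 1) < sectorCount (2 * n) := by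
  rw [sectorCount]
  exact Nat.pow_lt_pow_right (by norm_num) (by omega)

/-- The value of the quarter-shift permutation `ω ↦ ω + 2^{2n-1}` of `Fin N`. -/
theorem val_addRight_quarter (n : ℕ) [NeZero (sectorCount (2 * n))] (ω : Fin (sectorCount (2 * n))) :
    ((Equiv.addRight (⟨2 ^ (2 * n - 1), quarterShift_lt n⟩ : Fin (sectorCount (2 * n)))) ω : ℕ) =
      ((ω : ℕ) + 2 ^ (2 * n - 1)) % sectorCount (2 * n) := by
  rw [Equiv.coe_addRight, Fin.val_add]

section Assembly

variable (L M : ℕ) [NeZero M] {μ : ℝ} (hμ₁ : -4 < μ) (hμ₂ : μ < 0)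
include hμ₁ hμ₂

/-- **The sector sites are `D₄`-equivariant** (`-4 < μ < 0`, `n ≥ 1`): for every `γ ∈ D₄` a permutation `σ` of the
sector indices with `k⃗_{σ ω̄} = γ k⃗_ω̄`. -/
theorem klSectorSite_equivariant {n : ℕ} (hn : 1 ≤ n) (γ : DihedralGroup 4) :
    ∃ σ : Equiv.Perm (Fin (sectorCount (2 * n))), ∀ ω, klSectorSite L μ n (σ ω) = d4Site γ (klSectorSite L μ n ω) := by
  haveI : NeZero (sectorCount (2 * n)) := ⟨(sectorCount_pos _).ne'⟩
  refine DihedralGroup.forall_exists_of_generators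
    (fun γ (σ : Equiv.Perm (Fin (sectorCount (2 * n)))) => ∀ ω, klSectorSite L μ n (σ ω) = d4Site γ (klSectorSite L μ n ω))
    (fun σ₁ σ₂ => σ₂.trans σ₁) (Equiv.refl _) ?_ ?_ ?_ ?_ γ
  · intro ω; simp
  · intro γ₁ γ₂ σ₁ σ₂ h₁ h₂ ω
    rw [Equiv.trans_apply, h₁, h₂]
    exact (d4Site_mul_holds γ₁ γ₂ _).symm
  · refine ⟨Equiv.addRight (⟨2 ^ (2 * n - 1), quarterShift_lt n⟩ : Fin (sectorCount (2 * n))), fun ω => ?_⟩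
    exact klSectorSite_quarter L hμ₁ hμ₂ hn (val_addRight_quarter n ω)
  · exact ⟨Fin.revPerm, fun ω => by rw [Fin.revPerm_apply]; exact klSectorSite_rev L hμ₁ hμ₂ n ω⟩

variable [NeZero L]

/-- **The sector sites AND weights are `D₄`-equivariant** — the hypothesis `hπ` of `KLProgrammeLocalisedCooper.lean`
(`klLocCooperMatrix_d4Site`, `klLocCooperOp_comm`, `klLocBlockInf_eq_formInf`, `le_formInf_klLocCooperOp`) DISCHARGED: for
`-4 < μ < 0`, `n ≥ 1` and a scale-`n` shell avoiding the origin and the zone boundary, every `γ ∈ D₄` is realised on the sector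
indices by a permutation `σ` with `k⃗_{σω̄} = γ k⃗_ω̄` and `w_{σω̄} = w_ω̄`. -/
theorem klLocCooper_sectorEquivariance {β U : ℝ} {K : TrigPolyC4v} {e₀ : ℝ} {n : ℕ} (hn : 1 ≤ n)
    (hsh : ∀ k ∈ momentumShell L (nambuXiCT L μ K) (klScale e₀ n), k ≠ 0 ∧ ∀ j, 2 * (k j).val ≠ L) :
    ∀ γ : DihedralGroup 4, ∃ σ : Equiv.Perm (Fin (sectorCount (2 * n))),
      (∀ ω, klSectorSite L μ n (σ ω) = d4Site γ (klSectorSite L μ n ω)) ∧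
      (∀ ω, klSectorWeight L M β U μ K e₀ n (σ ω) = klSectorWeight L M β U μ K e₀ n ω) := by
  haveI : NeZero (sectorCount (2 * n)) := ⟨(sectorCount_pos _).ne'⟩
  refine DihedralGroup.forall_exists_of_generators
    (fun γ (σ : Equiv.Perm (Fin (sectorCount (2 * n)))) =>
      (∀ ω, klSectorSite L μ n (σ ω) = d4Site γ (klSectorSite L μ n ω)) ∧
      (∀ ω, klSectorWeight L M β U μ K e₀ n (σ ω) = klSectorWeight L M β U μ K e₀ n ω))
    (fun σ₁ σ₂ => σ₂.trans σ₁) (Equiv.refl _) ?_ ?_ ?_ ?_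
  · exact ⟨fun ω => by simp, fun ω => rfl⟩
  · rintro γ₁ γ₂ σ₁ σ₂ ⟨h₁, h₁'⟩ ⟨h₂, h₂'⟩
    refine ⟨fun ω => ?_, fun ω => ?_⟩
    · rw [Equiv.trans_apply, h₁, h₂]
      exact (d4Site_mul_holds γ₁ γ₂ _).symm
    · rw [Equiv.trans_apply, h₁', h₂']
  · refine ⟨Equiv.addRight (⟨2 ^ (2 * n - 1), quarterShift_lt n⟩ : Fin (sectorCount (2 * n))), fun ω => ?_, fun ω => ?_⟩
    · exact klSectorSite_quarter L hμ₁ hμ₂ hn (val_addRight_quarter n ω)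
    · exact klSectorWeight_quarter L M hn hsh (val_addRight_quarter n ω)
  · exact ⟨Fin.revPerm, fun ω => by rw [Fin.revPerm_apply]; exact klSectorSite_rev L hμ₁ hμ₂ n ω,
      fun ω => by rw [Fin.revPerm_apply]; exact klSectorWeight_rev L M hsh ω⟩

end Assembly

/-! ### §11 When does the shell avoid the origin and the zone boundary? -/

section ShellRegular

variable (L : ℕ) [NeZero L]

/-- **A shell inside the open annulus `0 < ε - μ < 4` avoids the origin and the zone boundary**: if
`Λ + Σ|κ| < -μ` and `Λ + Σ|κ| < 4 + μ` (`Σ|κ| = K.coeffNorm 0 ≥ sup |K|`), every `k⃗` with `|e_K(k⃗)| ≤ Λ` has `k⃗ ≠ 0` and no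
coordinate `p_i = π` (at `k⃗ = 0`, `ε = -4`; on the zone boundary `ε ≥ 0`). -/
theorem momentumShell_regular {μ Λ : ℝ} {K : TrigPolyC4v} (h₁ : Λ + K.coeffNorm 0 < -μ) (h₂ : Λ + K.coeffNorm 0 < 4 + μ) :
    ∀ k ∈ momentumShell L (nambuXiCT L μ K) Λ, k ≠ 0 ∧ ∀ j, 2 * (k j).val ≠ L := by
  intro k hk
  rw [mem_momentumShell, nambuXiCT, abs_le] at hk
  have hK := abs_le.1 (TrigPolyC4v.abs_eval_le_coeffNorm K (latticeMomentum L k))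
  have hL : (L : ℝ) ≠ 0 := by exact_mod_cast NeZero.ne L
  have hband : torusBand L k = -2 * (Real.cos (latticeMomentum L k 0) + Real.cos (latticeMomentum L k 1)) := by
    rw [torusBand, Fin.sum_univ_two]
  refine ⟨?_, ?_⟩
  · rintro rfl
    have h0 : ∀ i, latticeMomentum L (0 : TorusSite 2 L) i = 0 := fun i => by simp [latticeMomentum]
    rw [hband, h0, h0, Real.cos_zero] at hk
    linarith [hk.1]
  · intro j hj
    have hπ : latticeMomentum L k j = π := by
      have : (((k j).val : ℕ) : ℝ) = (L : ℝ) / 2 := by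
        have h' : ((2 * (k j).val : ℕ) : ℝ) = (L : ℝ) := by exact_mod_cast hj
        push_cast at h'
        linarith
      rw [latticeMomentum, this]
      field_simp
    have hj2 : j = 0 ∨ j = 1 := by
      rcases j with ⟨_ | _ | i, hi⟩
      · exact Or.inl rfl
      · exact Or.inr rfl
      · omega
    have hcos : Real.cos (latticeMomentum L k 0) + Real.cos (latticeMomentum L k 1) ≤ 0 := by
      rcases hj2 with rfl | rfl
      · rw [hπ, Real.cos_pi]
        linarith [Real.cos_le_one (latticeMomentum L k 1)]
      · rw [hπ, Real.cos_pi]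
        linarith [Real.cos_le_one (latticeMomentum L k 0)]
    rw [hband] at hk
    linarith [hk.2]

end ShellRegular

end Summit.HubbardSuperconductivity.HubbardSuperconductivity.Theorems.KLProgrammeLegKernels

end
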